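import Mathlib

/-!
# Shape packing for ordered escape ladders — pointwise-sum (Mathlib API) proof

Support file for item `stmt-MatrixMultiplication-14308` (`FourierTwoFamiliesModP.PrimeTwoFamilies`,
CKSU 2005 Conj. 4.7 with prime cyclic hosts), line Sketch, registered stub
`ladder_sum_card_mul_card_le_of_subshape` (siege k21, variation "Mathlib API route"; an independent
proof of the statement landed in namespace `…Theorems.PrimeTwoFamilies.LadderLift`).

A LADDER in an abelian group `G` is a family of `r` classes `(X c, Y c)`, `c : Fin r`, with

* (`hW`) every class direct: `(x - x') + (y - y') = 0` with `x, x' ∈ X c`, `y, y' ∈ Y c` forces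
  `x = x'` and `y = y'`;
* (`hL`) for classes `p < q` every cross difference `y' - x'` (`x' ∈ X p`, `y' ∈ Y q`) avoids every
  diagonal difference `y - x` (`x ∈ X c`, `y ∈ Y c`, any class `c`).

SHAPE PACKING.  If one pattern `Y₀` has a translate `u c +ᵥ Y₀ ⊆ Y c` for every `c ∈ S`, then
`(Σ_{c ∈ S} |X c|) · |Y₀| ≤ |G|`.

This proof is phrased entirely through Mathlib's pointwise `Finset` API: the Minkowski sums
`X c + Y₀` (`open Pointwise`) satisfy

1. `#(X c + Y₀) = #(X c) · #Y₀` (`Finset.card_add_iff`): a collision `a + b = a' + b'` inside class `c`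
   is `(a - a') + ((u c + b) - (u c + b')) = 0`, excluded by directness `hW` of class `c`;
2. the family `c ↦ X c + Y₀` is `PairwiseDisjoint` on `S` (`Finset.card_biUnion`): a coincidence
   `a + b = a' + b'` with `a ∈ X i`, `a' ∈ X k`, `i < k`, reads `(u k + b) - a' = (u k + b') - a`, a
   diagonal difference of class `k` equal to a cross difference from `X i × Y k`, excluded by `hL` at
   `(k, i, k)` (and symmetrically at `(i, k, i)` when `k < i`);
3. `#(S.biUnion fun c => X c + Y₀) ≤ Fintype.card G` (`Finset.card_le_univ`).
-/

-- single-conjunct summit: the mandated namespace repeats `MatrixMultiplication` (summit = sub-problem).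
set_option linter.dupNamespace false

namespace Summit.MatrixMultiplication.MatrixMultiplication.Theorems.PrimeTwoFamilies.LadderLift.SiegeK21

open Finset
open scoped Pointwise

/-- A collision of sums is a vanishing sum of differences, after translating the second summands
by a common `v`: `a + b = a' + b'` gives `(a - a') + ((v + b) - (v + b')) = 0`. -/
theorem sub_add_vadd_sub_vadd_eq_zero {G : Type*} [AddCommGroup G] {a a' b b' : G} (v : G)
    (h : a + b = a' + b') : (a - a') + ((v + b) - (v + b')) = 0 := by
  rw [add_sub_add_left_eq_sub, sub_add_sub_comm, h, sub_self]

/-- A collision of sums is an equality of translated differences: `a + b = a' + b'` gives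
`(v + b) - a' = (v + b') - a` for every `v`. -/
theorem vadd_sub_eq_vadd_sub {G : Type*} [AddCommGroup G] {a a' b b' : G} (v : G)
    (h : a + b = a' + b') : (v + b) - a' = (v + b') - a := by
  have hd : b - a' = b' - a := sub_eq_sub_iff_add_eq_add.2 (by rw [add_comm b a, h, add_comm a' b'])
  rw [add_sub_assoc, hd, add_sub_assoc]

/-- **Full Minkowski sums in a direct class.**  If class `c` is direct (`hW`) and contains the
translate `u +ᵥ Y₀ ⊆ Y` of the pattern `Y₀`, then addition is injective on `X ×ˢ Y₀`, i.e.
`#(X + Y₀) = #X · #Y₀` (`Finset.card_add_iff`). -/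
theorem card_add_eq_of_direct {G : Type*} [AddCommGroup G] [DecidableEq G] (X Y Y₀ : Finset G)
    (u : G)
    (hW : ∀ x ∈ X, ∀ x' ∈ X, ∀ y ∈ Y, ∀ y' ∈ Y, (x - x') + (y - y') = 0 → x = x' ∧ y = y')
    (hY : u +ᵥ Y₀ ⊆ Y) : (X + Y₀).card = X.card * Y₀.card := by
  rw [Finset.card_add_iff]
  rintro ⟨a, b⟩ ⟨ha, hb⟩ ⟨a', b'⟩ ⟨ha', hb'⟩ h
  simp only [Finset.mem_coe] at ha hb ha' hb'
  have hmem : ∀ y ∈ Y₀, u + y ∈ Y := fun y hy => hY (Finset.mem_vadd_finset.2 ⟨y, hy, rfl⟩)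
  obtain ⟨h1, h2⟩ :=
    hW a ha a' ha' (u + b) (hmem b hb) (u + b') (hmem b' hb') (sub_add_vadd_sub_vadd_eq_zero u h)
  exact Prod.ext h1 (add_left_cancel h2)

/-- **Distinct classes have disjoint Minkowski sums.**  In a ladder, if classes `i ≠ k` both
contain a translate of the pattern `Y₀` on their `Y`-side, then `X i + Y₀` and `X k + Y₀` are
disjoint: a common element is a diagonal difference of the larger class equal to a cross
difference, excluded by `hL`. -/
theorem disjoint_add_of_ladder {G : Type*} [AddCommGroup G] [DecidableEq G] {r : ℕ}
    (X Y : Fin r → Finset G)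
    (hL : ∀ c p q : Fin r, p < q → ∀ x ∈ X c, ∀ y ∈ Y c, ∀ x' ∈ X p, ∀ y' ∈ Y q, y - x ≠ y' - x')
    (Y₀ : Finset G) (u : Fin r → G) {i k : Fin r} (hik : i ≠ k) (hi : u i +ᵥ Y₀ ⊆ Y i)
    (hk : u k +ᵥ Y₀ ⊆ Y k) : Disjoint (X i + Y₀) (X k + Y₀) := by
  have hmem : ∀ (c : Fin r), u c +ᵥ Y₀ ⊆ Y c → ∀ y ∈ Y₀, u c + y ∈ Y c := fun c hc y hy =>
    hc (Finset.mem_vadd_finset.2 ⟨y, hy, rfl⟩)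
  rw [Finset.disjoint_left]
  intro z hzi hzk
  rw [Finset.mem_add] at hzi hzk
  obtain ⟨a, ha, b, hb, rfl⟩ := hzi
  obtain ⟨a', ha', b', hb', h⟩ := hzk
  -- `h : a' + b' = a + b`
  rcases lt_or_gt_of_ne hik with hlt | hlt
  · -- `i < k`: diagonal pair `(a', u k + b)` of class `k`, cross pair `(a, u k + b')` from `X i × Y k`
    exact hL k i k hlt a' ha' (u k + b) (hmem k hk b hb) a ha (u k + b') (hmem k hk b' hb')
      (vadd_sub_eq_vadd_sub (u k) h.symm)
  · -- `k < i`: diagonal pair `(a, u i + b')` of class `i`, cross pair `(a', u i + b)` from `X k × Y i`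
    exact hL i k i hlt a ha (u i + b') (hmem i hi b' hb') a' ha' (u i + b) (hmem i hi b hb)
      (vadd_sub_eq_vadd_sub (u i) h)

/-- **A common translated sub-pattern packs (ladders)** — registered stub
`ladder_sum_card_mul_card_le_of_subshape` of crux `stmt-MatrixMultiplication-14308`, proved through
the pointwise-sum API: the Minkowski sums `X c + Y₀`, `c ∈ S`, are full (`card_add_eq_of_direct`)
and pairwise disjoint (`disjoint_add_of_ladder`), so their `biUnion` has cardinality
`(Σ_{c ∈ S} #(X c)) · #Y₀ ≤ Fintype.card G`. -/
theorem ladder_sum_card_mul_card_le_of_subshape {G : Type*} [AddCommGroup G] [Fintype G]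
    [DecidableEq G] {r : ℕ} (X Y : Fin r → Finset G)
    (hW : ∀ c : Fin r, ∀ x ∈ X c, ∀ x' ∈ X c, ∀ y ∈ Y c, ∀ y' ∈ Y c,
      (x - x') + (y - y') = 0 → x = x' ∧ y = y')
    (hL : ∀ c p q : Fin r, p < q → ∀ x ∈ X c, ∀ y ∈ Y c, ∀ x' ∈ X p, ∀ y' ∈ Y q, y - x ≠ y' - x')
    (S : Finset (Fin r)) (Y₀ : Finset G) (u : Fin r → G) (hY : ∀ c ∈ S, u c +ᵥ Y₀ ⊆ Y c) :
    (∑ c ∈ S, (X c).card) * Y₀.card ≤ Fintype.card G := by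
  have hdisj : (S : Set (Fin r)).PairwiseDisjoint fun c => X c + Y₀ := fun i hi k hk hik =>
    disjoint_add_of_ladder X Y hL Y₀ u hik (hY i hi) (hY k hk)
  calc (∑ c ∈ S, (X c).card) * Y₀.card = ∑ c ∈ S, (X c + Y₀).card := by
        rw [Finset.sum_mul]
        exact Finset.sum_congr rfl fun c hc =>
          (card_add_eq_of_direct (X c) (Y c) Y₀ (u c) (hW c) (hY c hc)).symm
    _ = (S.biUnion fun c => X c + Y₀).card := (Finset.card_biUnion hdisj).symm
    _ ≤ Fintype.card G := Finset.card_le_univ _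

end Summit.MatrixMultiplication.MatrixMultiplication.Theorems.PrimeTwoFamilies.LadderLift.SiegeK21
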